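import Literature.MathematicalPhysics.QuantumFieldTheory.ConformalBootstrap3D.TwoSignRows
import Literature.MathematicalPhysics.QuantumFieldTheory.ConformalBootstrap3D.TwoWeightChord
import Literature.MathematicalPhysics.QuantumFieldTheory.ConformalBootstrap3D.PointFunctionalHead
import Literature.MathematicalPhysics.QuantumFieldTheory.ConformalBootstrap3D.PointCertificateTableLower
import Literature.MathematicalPhysics.QuantumFieldTheory.ConformalBootstrap3D.PointCertificateTableScover
import HarnessLib

/-!
# Head cells for rows pairing an `F₋` and an `F₊` point functional (vector-representation sum rules):
# the light blocks of the trial range, the unit row, (M) boxes with a term-rule bit, and the gluing of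
# cells into range obligations

Topic `MathematicalPhysics/QuantumFieldTheory/ConformalBootstrap3D`; definitions + theorems only (no
named fact, no instance, no `sorry`).

`TwoSignRows` decides the TAIL of a two-sign row `g ↦ φ[a⁻](F^{s}_{-}[g]) + φ[a⁺](F^{s}_{+}[g])`
(`TwoSignPositive a⁻ a⁺ z z̄ s Δ ℓ`; the row shape of the `O(N)` vector sum rule of
Kos–Poland–Simmons-Duffin 2014, §2.1, `V_S = (0, F⁻, F⁺)`, `V_T = (F⁻, (1-2/N)F⁻, -(1+2/N)F⁺)`,
`V_A = (-F⁻, F⁻, -F⁺)`, and of the off-diagonal even sector of a mixed correlator) from finitely many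
numbers.  This file does the same for the LIGHT blocks — the `Δ`-cells of the trial range below the
tail threshold — by transporting the head-cell rules of the one-functional point certificates
(Hogervorst–Rychkov `z`-series; `PointFunctionalHead`: monotone coefficient tables
`A_{n,j}(Δ) ∈ [A⁻, A⁺]` from `hrCoeff_mem_Icc_cell`, cell start `≥ ℓ + 1`; `PointCertificateTableLower`:
interval tables `hrCoeffLo/Hi` from `hrCoeff_mem_Icc_interval`, cell start strictly above the unitarity
bound; ONE number `Σ_{(n,j) ∈ F} min(lo·Φlo, hi·Φlo) ≥ 0` per cell for a table `Φlo` of term bounds)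
to the two-sign row, with BOTH term-bound tables the point readers know: the first-order corner numbers
`cornerBound₂` (`MixedEvenTail`) and the second-order chord numbers `termChordMin₂` (`TwoWeightChord`).
Nothing in the head-cell rules used the sign: the row term is
`twoSignTerm a⁻ a⁺ z z̄ s E j = twoWeightEval (a⁻+a⁺) (a⁻-a⁺) z z̄ s 𝒫_{E,j}` (`twoSignTerm_eq_twoWeightEval`)
and the block coefficients `A_{n,j}(Δ) ≥ 0` are the same.

* `twoSignPositive_of_headSum` / `_Ico` (monotone tables, `ℓ + 1 ≤ a`) and
  `twoSignPositive_of_headSumI` / `_Ico` (interval tables, `unitarityBound3D ℓ < a`) — the head-cell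
  rule with ANY table `Φlo` of per-term lower bounds (regular `Δ ∈ [a,b]`; every `Δ ∈ [a,b)` by the
  limit clause `twoSignPositive_of_eventually_right`);
* `cornerBound₂_le_twoSignTerm`, `termChordMin₂_le_twoSignTerm` — the two term-bound tables on a box
  (chord: node ratios `≥ 1/2` for the `s`-width and the `E`-width); the cell numbers
  `headCellBound₂` / `headChordBound₂` (monotone × corner / chord), `headCellBoundI₂` /
  `headChordBoundI₂` (interval × corner / chord), and `headCellNumber₂ … n_F useChord useInterval` —
  ONE number per cell on the canonical head set `headSet ℓ n_F` with two rule bits, exactly as the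
  one-functional `headNumber₂`;
* `headSum_twoSign_of_rules` / `headSumI_twoSign_of_rules` / `headCell₂_twoSign_of_rules` — the tail
  terms of a head cell discharged by the row's GLOBAL data as in the tail theorem: rule (M) on the
  twist-gap domain `E ∈ [E₀, E_T)`, `j + τ ≤ E` (`τ ≤ 1`) and rule (T) from `E_T` on (ONE apex
  inequality, `twoWeightEval_zMono_nonneg_of_apex`), provided every index outside the head set has
  `a + n ≥ E₀` (`a + n_F + 1 ≥ E₀`);
* `boxNumber₂ … useChord`, `twoSignTerm_nonneg_of_boxNumber₂`, `ruleM_twoSign_of_boxTable₂`,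
  `tail_twoSignPositive_of_table₂_and_apex` — rule (M) and the row's TAIL from a box table whose boxes
  carry a term-rule bit (corner `cornerBound₂` | chord `termChordMin₂`), refining the corner-only
  `ruleM_twoSign_of_boxTable` / `tail_twoSignPositive_of_table_and_apex` of `TwoSignRows`;
* `twoSign_identity_eq` / `twoSign_identity_pos_of_cornerBound₂` /
  `twoSign_identity_pos_of_chordMin₂` / `twoSign_identity_pos_of_chordRow₂` — the unit row
  `φ[a⁻](F^{s}_{-}[1]) + φ[a⁺](F^{s}_{+}[1]) = twoSignTerm a⁻ a⁺ z z̄ s 0 0 > 0` on `[s_lo, s_hi]`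
  from ONE corner number, or from a chord ROW (a monotone partition of the `s`-width with one
  chord number `> 0` per piece, as the one-functional `identity_pos_of_chordRow`) — obligation
  (O1) of a vector certificate: `α(V_S[1]) > 0`;
* `twoSignPositive_of_cells_Ico`, `scalar_twoSign_of_cells`, `spin_twoSign_of_cells`
  (`evenSpin_…`, `oddSpin_…`) — consecutive half-open cells glued into the range obligations
  "`Δ_gap ≤ Δ < E`, `ℓ = 0`" and "`ℓ + 1 ≤ Δ < E` for every spin `ℓ < L` with a prescribed property
  `P ℓ`" (`P` = `Even ∧ ≠ 0` for the singlet / traceless-symmetric rows, `Odd` for the antisymmetric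
  row; `E ≤ L + 1` bounds the spins that occur below the threshold);
* `scalarRange_twoSign_of_pointTables` / `spinRange_twoSign_of_pointTables` — a whole row family's
  trial range from FINITE TABLES: per cell a head level `n_F`, a term bit, (scalar row) a
  coefficient bit (monotone: start `≥ 1`; interval: start `> 1/2` and `≥ τ` — gaps between the
  unitarity bound and `1`), chord cells with node ratios `≥ 1/2` for the width, and ONE
  `headCellNumber₂ ≥ 0`; the (M) box table with term bits; the ONE apex inequality of the family's
  tail; the global `s`-width node-ratio condition.

With `TwoSignRows` (tails) this makes a two-sign row certificate a FINITE TABLE of the primitives the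
one-functional point readers already evaluate (`hrCoeff` endpoint values and pivot products,
`hrCoeffLo/Hi`, `cornerBound₂` and `termChordMin₂` numbers, one `apexRest₂` inequality per row
family) — the format in which a client cell's `O(N)` vector points certificate is checked, at parity
with the one-functional kind (corner | chord) × (monotone | interval); the dictionary from
`TwoSignPositive` at the weights `(wSm, wSp)`, `(wTm N, wTp N)`, `(wAm, wAp)` to the rows of
`ONVectorCertificate` is `rowNonnegS/T/A_of_crossF` there.  No number of any client cell is asserted
here.

References: M. Hogervorst, S. Rychkov, "Radial coordinates for conformal blocks", Phys. Rev. D 87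
(2013) 106004, arXiv:1303.1111, §3 eq. (3.6)/(3.9) [key HogervorstRychkov2013] (term basis,
coefficient bounds); F. Kos, D. Poland, D. Simmons-Duffin, "Bootstrapping the O(N) vector models",
JHEP 06 (2014) 091, arXiv:1307.6856, §2.1 [key KosPolandSimmonsduffin2014ON] (the row shape);
R. Rattazzi, V. Rychkov, E. Tonni, A. Vichi, JHEP 12 (2008) 031, arXiv:0807.0004, §5.5
[key RattazziEtAl2008] (linear-functional exclusion, obligations by sector and range); D. Poland,
S. Rychkov, A. Vichi, Rev. Mod. Phys. 91 (2019) 015002, arXiv:1805.04405, §II.C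
[key PolandRychkovVichi2019].
-/

noncomputable section

namespace Literature.MathematicalPhysics.QuantumFieldTheory.ConformalBootstrap3D

open Finset Set Filter Topology

/-! ### The head-cell rule for two-sign rows, monotone coefficient tables, any table of term bounds -/

/-- **Head cell rule with a table of term bounds, regular points.** Nodes in the open square,
`ℓ + 1 ≤ a`; if `Φlo (n,j)` bounds the row term `twoSignTerm a⁻ a⁺ z z̄ s (Δ+n) j` from below on the
cell `Δ ∈ [a, b]`, `headCellSum ℓ a b F Φlo ≥ 0`, and every term outside `F` on the descendant range is
non-negative for `E ∈ [a+n, b+n]`, then the row is non-negative at every REGULAR `Δ ∈ [a, b]`.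
[cite: HogervorstRychkov2013, §3 eq. (3.9)] -/
theorem twoSignPositive_of_headSum {n : ℕ} (am ap z zb : Fin n → ℝ)
    (hz : ∀ k, z k ∈ Ioo (0 : ℝ) 1) (hzb : ∀ k, zb k ∈ Ioo (0 : ℝ) 1) {ℓ : ℕ} {a b s : ℝ}
    (ha : (ℓ : ℝ) + 1 ≤ a) (F : Finset (ℕ × ℕ)) (Φlo : ℕ × ℕ → ℝ)
    (hΦ : ∀ q ∈ F, ∀ Δ ∈ Icc a b, Φlo q ≤ twoSignTerm am ap z zb s (Δ + (q.1 : ℝ)) q.2)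
    (hhead : 0 ≤ headCellSum ℓ a b F Φlo)
    (htail : ∀ q : ℕ × ℕ, q ∉ F → InDescendantRange ℓ q.1 q.2 →
      ∀ E ∈ Icc (a + q.1) (b + q.1), 0 ≤ twoSignTerm am ap z zb s E q.2) :
    ∀ Δ ∈ Icc a b, IsRegularPoint3D Δ ℓ → TwoSignPositive am ap z zb s Δ ℓ := by
  intro Δ hΔ hreg
  have hbd : unitarityBound3D ℓ ≤ Δ := ((unitarityBound3D_le_add_one ℓ).trans ha).trans hΔ.1
  have hlt : unitarityBound3D ℓ < Δ := lt_of_le_of_ne hbd (fun h => hreg.1 h.symm)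
  refine twoSignPositive_of_termwise am ap z zb hz hzb hlt hreg.2 F ?_ ?_
  · -- the head
    have hlam : 0 < legendreLam ℓ := legendreLam_pos ℓ
    have hterm : ∀ q ∈ F,
        (1 / legendreLam ℓ) * min
          (hrCoeff a ℓ q.1 q.2 * (pivotProd a ℓ q.1 / pivotProd b ℓ q.1) * Φlo q)
          (hrCoeff b ℓ q.1 q.2 * (pivotProd b ℓ q.1 / pivotProd a ℓ q.1) * Φlo q) ≤
        hrCoeff Δ ℓ q.1 q.2 / legendreLam ℓ * twoSignTerm am ap z zb s (Δ + (q.1 : ℝ)) q.2 := by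
      intro q hq
      have hA := hrCoeff_mem_Icc_cell ha hΔ.1 hΔ.2 q.1 q.2
      have hmin := min_mul_le_mul_of_bounds hA.1 hA.2 (hrCoeff_nonneg_of_le (ha.trans hΔ.1) _ _)
        (hΦ q hq Δ hΔ)
      have hrw : hrCoeff Δ ℓ q.1 q.2 / legendreLam ℓ * twoSignTerm am ap z zb s (Δ + (q.1 : ℝ)) q.2 =
          (1 / legendreLam ℓ) *
            (hrCoeff Δ ℓ q.1 q.2 * twoSignTerm am ap z zb s (Δ + (q.1 : ℝ)) q.2) := by ring
      rw [hrw]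
      exact mul_le_mul_of_nonneg_left hmin (by positivity)
    calc (0 : ℝ) ≤ (1 / legendreLam ℓ) * headCellSum ℓ a b F Φlo := mul_nonneg (by positivity) hhead
      _ = ∑ q ∈ F, (1 / legendreLam ℓ) * min
          (hrCoeff a ℓ q.1 q.2 * (pivotProd a ℓ q.1 / pivotProd b ℓ q.1) * Φlo q)
          (hrCoeff b ℓ q.1 q.2 * (pivotProd b ℓ q.1 / pivotProd a ℓ q.1) * Φlo q) := by
          rw [headCellSum, Finset.mul_sum]
      _ ≤ _ := Finset.sum_le_sum hterm
  · -- the tail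
    intro q hq hr
    exact htail q hq hr (Δ + (q.1 : ℝ)) ⟨by linarith [hΔ.1], by linarith [hΔ.2]⟩

/-- **Head cell rule with a table of term bounds, half-open cell**: every `Δ ∈ [a, b)`, the
non-regular points (the bound `a = ℓ + 1` itself, accidental degeneracies) by the limit clause from the
regular points to their right inside the cell. [cite: HogervorstRychkov2013, §3 eq. (3.9)] -/
theorem twoSignPositive_of_headSum_Ico {n : ℕ} (am ap z zb : Fin n → ℝ)
    (hz : ∀ k, z k ∈ Ioo (0 : ℝ) 1) (hzb : ∀ k, zb k ∈ Ioo (0 : ℝ) 1) {ℓ : ℕ} {a b s : ℝ}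
    (ha : (ℓ : ℝ) + 1 ≤ a) (F : Finset (ℕ × ℕ)) (Φlo : ℕ × ℕ → ℝ)
    (hΦ : ∀ q ∈ F, ∀ Δ ∈ Icc a b, Φlo q ≤ twoSignTerm am ap z zb s (Δ + (q.1 : ℝ)) q.2)
    (hhead : 0 ≤ headCellSum ℓ a b F Φlo)
    (htail : ∀ q : ℕ × ℕ, q ∉ F → InDescendantRange ℓ q.1 q.2 →
      ∀ E ∈ Icc (a + q.1) (b + q.1), 0 ≤ twoSignTerm am ap z zb s E q.2) :
    ∀ Δ ∈ Ico a b, TwoSignPositive am ap z zb s Δ ℓ := by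
  intro Δ hΔ
  have hreg := twoSignPositive_of_headSum am ap z zb hz hzb ha F Φlo hΦ hhead htail
  by_cases hr : IsRegularPoint3D Δ ℓ
  · exact hreg Δ ⟨hΔ.1, hΔ.2.le⟩ hr
  · have hbd : unitarityBound3D ℓ ≤ Δ := ((unitarityBound3D_le_add_one ℓ).trans ha).trans hΔ.1
    refine twoSignPositive_of_eventually_right am ap z zb hz hzb s Δ ℓ hr ?_
    filter_upwards [eventually_isRegularPoint3D_nhdsGT_of_bound_le hbd, Ioo_mem_nhdsGT hΔ.2]
      with Δ' hΔ'reg hΔ'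
    exact ⟨hΔ'reg, hreg Δ' ⟨hΔ.1.trans hΔ'.1.le, hΔ'.2.le⟩ hΔ'reg⟩

/-! ### The head-cell rule, interval coefficient tables (cells strictly above the unitarity bound) -/

/-- **Interval head cell rule for two-sign rows, regular points.** Cell start STRICTLY above the
unitarity bound (`ℓ = 0`: `a > 1/2`; the scalar cells between the bound and `ℓ + 1`, where the
monotone tables do not apply), coefficient bounds from the interval-recursion tables `hrCoeffLo/Hi`
(`hrCoeff_mem_Icc_interval`), ONE number `headCellSumI ℓ a b F Φlo ≥ 0` for a table `Φlo` of term
bounds on the cell. [cite: HogervorstRychkov2013, §3 eq. (3.9)] -/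
theorem twoSignPositive_of_headSumI {n : ℕ} (am ap z zb : Fin n → ℝ)
    (hz : ∀ k, z k ∈ Ioo (0 : ℝ) 1) (hzb : ∀ k, zb k ∈ Ioo (0 : ℝ) 1) {ℓ : ℕ} {a b s : ℝ}
    (ha : unitarityBound3D ℓ < a) (F : Finset (ℕ × ℕ)) (Φlo : ℕ × ℕ → ℝ)
    (hΦ : ∀ q ∈ F, ∀ Δ ∈ Icc a b, Φlo q ≤ twoSignTerm am ap z zb s (Δ + (q.1 : ℝ)) q.2)
    (hhead : 0 ≤ headCellSumI ℓ a b F Φlo)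
    (htail : ∀ q : ℕ × ℕ, q ∉ F → InDescendantRange ℓ q.1 q.2 →
      ∀ E ∈ Icc (a + q.1) (b + q.1), 0 ≤ twoSignTerm am ap z zb s E q.2) :
    ∀ Δ ∈ Icc a b, IsRegularPoint3D Δ ℓ → TwoSignPositive am ap z zb s Δ ℓ := by
  intro Δ hΔ hreg
  have hlt : unitarityBound3D ℓ < Δ := lt_of_lt_of_le ha hΔ.1
  refine twoSignPositive_of_termwise am ap z zb hz hzb hlt hreg.2 F ?_ ?_
  · -- the head
    have hlam : 0 < legendreLam ℓ := legendreLam_pos ℓ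
    have hterm : ∀ q ∈ F,
        (1 / legendreLam ℓ) *
            min (hrCoeffLo a b ℓ q.1 q.2 * Φlo q) (hrCoeffHi a b ℓ q.1 q.2 * Φlo q) ≤
          hrCoeff Δ ℓ q.1 q.2 / legendreLam ℓ * twoSignTerm am ap z zb s (Δ + (q.1 : ℝ)) q.2 := by
      intro q hq
      have hA := hrCoeff_mem_Icc_interval ha hΔ.1 hΔ.2 q.1 q.2
      have hmin := min_mul_le_mul_of_bounds hA.2.1 hA.2.2 (hA.1.trans hA.2.1) (hΦ q hq Δ hΔ)
      have hrw : hrCoeff Δ ℓ q.1 q.2 / legendreLam ℓ * twoSignTerm am ap z zb s (Δ + (q.1 : ℝ)) q.2 =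
          (1 / legendreLam ℓ) *
            (hrCoeff Δ ℓ q.1 q.2 * twoSignTerm am ap z zb s (Δ + (q.1 : ℝ)) q.2) := by ring
      rw [hrw]
      exact mul_le_mul_of_nonneg_left hmin (by positivity)
    calc (0 : ℝ) ≤ (1 / legendreLam ℓ) * headCellSumI ℓ a b F Φlo := mul_nonneg (by positivity) hhead
      _ = ∑ q ∈ F, (1 / legendreLam ℓ) *
            min (hrCoeffLo a b ℓ q.1 q.2 * Φlo q) (hrCoeffHi a b ℓ q.1 q.2 * Φlo q) := by
          rw [headCellSumI, Finset.mul_sum]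
      _ ≤ _ := Finset.sum_le_sum hterm
  · -- the tail
    intro q hq hr
    exact htail q hq hr (Δ + (q.1 : ℝ)) ⟨by linarith [hΔ.1], by linarith [hΔ.2]⟩

/-- **Interval head cell rule for two-sign rows, half-open cell** (limit clause at the non-regular
points). [cite: HogervorstRychkov2013, §3 eq. (3.9)] -/
theorem twoSignPositive_of_headSumI_Ico {n : ℕ} (am ap z zb : Fin n → ℝ)
    (hz : ∀ k, z k ∈ Ioo (0 : ℝ) 1) (hzb : ∀ k, zb k ∈ Ioo (0 : ℝ) 1) {ℓ : ℕ} {a b s : ℝ}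
    (ha : unitarityBound3D ℓ < a) (F : Finset (ℕ × ℕ)) (Φlo : ℕ × ℕ → ℝ)
    (hΦ : ∀ q ∈ F, ∀ Δ ∈ Icc a b, Φlo q ≤ twoSignTerm am ap z zb s (Δ + (q.1 : ℝ)) q.2)
    (hhead : 0 ≤ headCellSumI ℓ a b F Φlo)
    (htail : ∀ q : ℕ × ℕ, q ∉ F → InDescendantRange ℓ q.1 q.2 →
      ∀ E ∈ Icc (a + q.1) (b + q.1), 0 ≤ twoSignTerm am ap z zb s E q.2) :
    ∀ Δ ∈ Ico a b, TwoSignPositive am ap z zb s Δ ℓ := by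
  intro Δ hΔ
  have hreg := twoSignPositive_of_headSumI am ap z zb hz hzb ha F Φlo hΦ hhead htail
  by_cases hr : IsRegularPoint3D Δ ℓ
  · exact hreg Δ ⟨hΔ.1, hΔ.2.le⟩ hr
  · have hbd : unitarityBound3D ℓ ≤ Δ := ha.le.trans hΔ.1
    refine twoSignPositive_of_eventually_right am ap z zb hz hzb s Δ ℓ hr ?_
    filter_upwards [eventually_isRegularPoint3D_nhdsGT_of_bound_le hbd, Ioo_mem_nhdsGT hΔ.2]
      with Δ' hΔ'reg hΔ'
    exact ⟨hΔ'reg, hreg Δ' ⟨hΔ.1.trans hΔ'.1.le, hΔ'.2.le⟩ hΔ'reg⟩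

/-! ### The two term-bound tables on a box -/

/-- The corner number bounds the row term on the box `[E₁, E₂] × [s_lo, s_hi]` (first order).
[cite: HogervorstRychkov2013, §3 eq. (3.6)] -/
theorem cornerBound₂_le_twoSignTerm {n : ℕ} (am ap z zb : Fin n → ℝ)
    (hz : ∀ k, z k ∈ Ioo (0 : ℝ) 1) (hzb : ∀ k, zb k ∈ Ioo (0 : ℝ) 1) (j : ℕ)
    {E₁ E₂ slo shi E s : ℝ} (hE : E ∈ Icc E₁ E₂) (hs : s ∈ Icc slo shi) :
    cornerBound₂ (am + ap) (am - ap) z zb j E₁ E₂ slo shi ≤ twoSignTerm am ap z zb s E j := by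
  rw [twoSignTerm_eq_twoWeightEval]
  exact cornerBound₂_le (am + ap) (am - ap) z zb hz hzb j hE hs

/-- The chord number bounds the row term on the box (second order; node ratios `≥ 1/2` for the
`s`-width and the `E`-width). [cite: HogervorstRychkov2013, §3 eq. (3.6)] -/
theorem termChordMin₂_le_twoSignTerm {n : ℕ} (am ap z zb : Fin n → ℝ)
    (hz : ∀ k, z k ∈ Ioo (0 : ℝ) 1) (hzb : ∀ k, zb k ∈ Ioo (0 : ℝ) 1) (j : ℕ)
    {slo shi E₁ E₂ E s : ℝ}
    (hr : ∀ k, 1 / 2 ≤ ((1 - z k) * (1 - zb k)) ^ (shi - slo) ∧ 1 / 2 ≤ (z k * zb k) ^ (shi - slo))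
    (hρ : ∀ k, 1 / 2 ≤ (z k * zb k) ^ ((E₂ - E₁) / 2) ∧
      1 / 2 ≤ ((1 - z k) * (1 - zb k)) ^ ((E₂ - E₁) / 2))
    (hE : E ∈ Icc E₁ E₂) (hs : s ∈ Icc slo shi) :
    termChordMin₂ (am + ap) (am - ap) z zb j slo shi E₁ E₂ ≤ twoSignTerm am ap z zb s E j := by
  rw [twoSignTerm_eq_twoWeightEval]
  exact termChordMin₂_le (am + ap) (am - ap) z zb hz hzb j hr hρ hs hE

/-! ### The cell numbers: (monotone | interval) × (corner | chord) -/

/-- Monotone coefficient tables, corner term bounds on `[a+n, b+n] × [s_lo, s_hi]`.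
[cite: HogervorstRychkov2013, §3 eq. (3.9)] -/
def headCellBound₂ {n : ℕ} (am ap z zb : Fin n → ℝ) (ℓ : ℕ) (a b slo shi : ℝ)
    (F : Finset (ℕ × ℕ)) : ℝ :=
  headCellSum ℓ a b F
    (fun q => cornerBound₂ (am + ap) (am - ap) z zb q.2 (a + q.1) (b + q.1) slo shi)

/-- Monotone coefficient tables, chord term bounds. [cite: HogervorstRychkov2013, §3 eq. (3.9)] -/
def headChordBound₂ {n : ℕ} (am ap z zb : Fin n → ℝ) (ℓ : ℕ) (a b slo shi : ℝ)
    (F : Finset (ℕ × ℕ)) : ℝ :=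
  headCellSum ℓ a b F
    (fun q => termChordMin₂ (am + ap) (am - ap) z zb q.2 slo shi (a + q.1) (b + q.1))

/-- Interval coefficient tables, corner term bounds. [cite: HogervorstRychkov2013, §3 eq. (3.9)] -/
def headCellBoundI₂ {n : ℕ} (am ap z zb : Fin n → ℝ) (ℓ : ℕ) (a b slo shi : ℝ)
    (F : Finset (ℕ × ℕ)) : ℝ :=
  headCellSumI ℓ a b F
    (fun q => cornerBound₂ (am + ap) (am - ap) z zb q.2 (a + q.1) (b + q.1) slo shi)

/-- Interval coefficient tables, chord term bounds. [cite: HogervorstRychkov2013, §3 eq. (3.9)] -/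
def headChordBoundI₂ {n : ℕ} (am ap z zb : Fin n → ℝ) (ℓ : ℕ) (a b slo shi : ℝ)
    (F : Finset (ℕ × ℕ)) : ℝ :=
  headCellSumI ℓ a b F
    (fun q => termChordMin₂ (am + ap) (am - ap) z zb q.2 slo shi (a + q.1) (b + q.1))

/-- **The number of a two-sign head cell** on the canonical head set `headSet ℓ n_F` with two rule
bits: term bounds corner / chord (`useChord`), coefficient tables monotone (cell start `≥ ℓ + 1`) /
interval (cell start `> unitarityBound3D ℓ` and `≥ ℓ + τ`) (`useInterval`) — the two-sign analogue of
`headNumber₂`. [cite: HogervorstRychkov2013, §3 eq. (3.9)] -/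
def headCellNumber₂ {n : ℕ} (am ap z zb : Fin n → ℝ) (ℓ : ℕ) (a b slo shi : ℝ) (nF : ℕ)
    (useChord useInterval : Bool) : ℝ :=
  if useInterval then
    (if useChord then headChordBoundI₂ am ap z zb ℓ a b slo shi (headSet ℓ nF)
      else headCellBoundI₂ am ap z zb ℓ a b slo shi (headSet ℓ nF))
  else
    (if useChord then headChordBound₂ am ap z zb ℓ a b slo shi (headSet ℓ nF)
      else headCellBound₂ am ap z zb ℓ a b slo shi (headSet ℓ nF))

/-! ### Head cells from the row's global data: (M) on the twist-gap domain and (T) from an apex -/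

/-- **Head cell from the row's global data (any table of term bounds).** The external dimension runs
over `[s_lo, s_hi]`, `Φlo` bounds the head terms from below for all of them, and the tail terms are
discharged by the row's rules: every index outside `F` on the descendant range has `a + n ≥ E₀`,
(M) gives termwise positivity for `E ∈ [E₀, E_T)`, `j + τ ≤ E` (`τ ≤ 1`, so that `j ≤ ℓ + n`,
`ℓ + 1 ≤ a` put every descendant term of the cell in the domain), and (T) — apex domination with ONE
inequality at `(s_lo, E_T)` — from `E_T` on. [cite: HogervorstRychkov2013, §3 eq. (3.9)] -/
theorem headSum_twoSign_of_rules {n : ℕ} (am ap z zb : Fin n → ℝ)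
    (hz : ∀ k, z k ∈ Ioo (0 : ℝ) 1) (hzb : ∀ k, zb k ∈ Ioo (0 : ℝ) 1) (hord : ∀ k, zb k ≤ z k)
    (apex : Fin n) (hapex : 0 ≤ am apex + ap apex) (qd qr : Fin n → ℝ)
    (hqd : ∀ k, 0 < qd k ∧ qd k ≤ 1) (hqr : ∀ k, 0 < qr k ∧ qr k ≤ 1)
    (hdomd : ∀ k, z k * zb k ≤ qd k ^ 2 * (z apex * zb apex) ∧ z k ≤ qd k * z apex)
    (hdomr : ∀ k, (1 - z k) * (1 - zb k) ≤ qr k ^ 2 * (z apex * zb apex) ∧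
      1 - zb k ≤ qr k * z apex)
    {slo shi E₀ ET τ : ℝ} (hτ1 : τ ≤ 1)
    (hM : ∀ (j : ℕ) (E : ℝ), E₀ ≤ E → E < ET → (j : ℝ) + τ ≤ E → ∀ s ∈ Icc slo shi,
      0 ≤ twoSignTerm am ap z zb s E j)
    (hB : apexRest₂ (am + ap) (am - ap) z zb apex qd qr slo ET ≤
      (am apex + ap apex) * ((1 - z apex) * (1 - zb apex)) ^ shi)
    {ℓ : ℕ} {a b : ℝ} (ha : (ℓ : ℝ) + 1 ≤ a) (F : Finset (ℕ × ℕ))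
    (hF : ∀ q : ℕ × ℕ, q ∉ F → InDescendantRange ℓ q.1 q.2 → E₀ ≤ a + q.1)
    (Φlo : ℕ × ℕ → ℝ)
    (hΦ : ∀ q ∈ F, ∀ Δ ∈ Icc a b, ∀ s ∈ Icc slo shi,
      Φlo q ≤ twoSignTerm am ap z zb s (Δ + (q.1 : ℝ)) q.2)
    (hhead : 0 ≤ headCellSum ℓ a b F Φlo) :
    ∀ s ∈ Icc slo shi, ∀ Δ ∈ Ico a b, TwoSignPositive am ap z zb s Δ ℓ := by
  intro s hs
  refine twoSignPositive_of_headSum_Ico am ap z zb hz hzb ha F Φlo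
    (fun q hq Δ hΔ => hΦ q hq Δ hΔ s hs) hhead ?_
  intro q hq hr E hE
  have h1 : q.2 ≤ ℓ + q.1 := hr.2.1
  have h2 : (q.2 : ℝ) ≤ (ℓ : ℝ) + q.1 := by exact_mod_cast h1
  have hjτ : (q.2 : ℝ) + τ ≤ E := by linarith [hE.1]
  have hjE : (q.2 : ℝ) ≤ E := by linarith [hE.1]
  have hE0 : E₀ ≤ E := (hF q hq hr).trans hE.1
  by_cases hET : E < ET
  · exact hM q.2 E hE0 hET hjτ s hs
  · rw [twoSignTerm_eq_twoWeightEval]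
    exact twoWeightEval_zMono_nonneg_of_apex (am + ap) (am - ap) z zb hz hzb hord apex hapex qd qr
      hqd hqr hdomd hdomr hB E (not_lt.1 hET) q.2 hjE s hs

/-- **Interval head cell from the row's global data (any table of term bounds).** Cell start
`a > unitarityBound3D ℓ` and `a ≥ ℓ + τ`; every index outside `F` on the descendant range has
`a + n ≥ E₀`, so its terms live at `E ≥ a + n ≥ j + τ` (`j ≤ ℓ + n`), where (M) (`E < E_T`) or the
apex rule (T) (`E ≥ E_T`) applies. [cite: HogervorstRychkov2013, §3 eq. (3.9)] -/
theorem headSumI_twoSign_of_rules {n : ℕ} (am ap z zb : Fin n → ℝ)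
    (hz : ∀ k, z k ∈ Ioo (0 : ℝ) 1) (hzb : ∀ k, zb k ∈ Ioo (0 : ℝ) 1) (hord : ∀ k, zb k ≤ z k)
    (apex : Fin n) (hapex : 0 ≤ am apex + ap apex) (qd qr : Fin n → ℝ)
    (hqd : ∀ k, 0 < qd k ∧ qd k ≤ 1) (hqr : ∀ k, 0 < qr k ∧ qr k ≤ 1)
    (hdomd : ∀ k, z k * zb k ≤ qd k ^ 2 * (z apex * zb apex) ∧ z k ≤ qd k * z apex)
    (hdomr : ∀ k, (1 - z k) * (1 - zb k) ≤ qr k ^ 2 * (z apex * zb apex) ∧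
      1 - zb k ≤ qr k * z apex)
    {slo shi E₀ ET τ : ℝ}
    (hM : ∀ (j : ℕ) (E : ℝ), E₀ ≤ E → E < ET → (j : ℝ) + τ ≤ E → ∀ s ∈ Icc slo shi,
      0 ≤ twoSignTerm am ap z zb s E j)
    (hB : apexRest₂ (am + ap) (am - ap) z zb apex qd qr slo ET ≤
      (am apex + ap apex) * ((1 - z apex) * (1 - zb apex)) ^ shi)
    {ℓ : ℕ} {a b : ℝ} (ha : unitarityBound3D ℓ < a) (haτ : (ℓ : ℝ) + τ ≤ a) (F : Finset (ℕ × ℕ))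
    (hF : ∀ q : ℕ × ℕ, q ∉ F → InDescendantRange ℓ q.1 q.2 → E₀ ≤ a + q.1)
    (Φlo : ℕ × ℕ → ℝ)
    (hΦ : ∀ q ∈ F, ∀ Δ ∈ Icc a b, ∀ s ∈ Icc slo shi,
      Φlo q ≤ twoSignTerm am ap z zb s (Δ + (q.1 : ℝ)) q.2)
    (hhead : 0 ≤ headCellSumI ℓ a b F Φlo) :
    ∀ s ∈ Icc slo shi, ∀ Δ ∈ Ico a b, TwoSignPositive am ap z zb s Δ ℓ := by
  intro s hs
  refine twoSignPositive_of_headSumI_Ico am ap z zb hz hzb ha F Φlo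
    (fun q hq Δ hΔ => hΦ q hq Δ hΔ s hs) hhead ?_
  intro q hq hr E hE
  have h1 : q.2 ≤ ℓ + q.1 := hr.2.1
  have h2 : (q.2 : ℝ) ≤ (ℓ : ℝ) + q.1 := by exact_mod_cast h1
  have hjτ : (q.2 : ℝ) + τ ≤ E := by linarith [hE.1]
  have hjE : (q.2 : ℝ) ≤ E := by linarith [hE.1, natCast_add_half_le_unitarityBound3D ℓ]
  have hE0 : E₀ ≤ E := (hF q hq hr).trans hE.1
  by_cases hET : E < ET
  · exact hM q.2 E hE0 hET hjτ s hs
  · rw [twoSignTerm_eq_twoWeightEval]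
    exact twoWeightEval_zMono_nonneg_of_apex (am + ap) (am - ap) z zb hz hzb hord apex hapex qd qr
      hqd hqr hdomd hdomr hB E (not_lt.1 hET) q.2 hjE s hs

/-- **One two-sign head cell from its number, its rule bits and the row's rules.** Head level `n_F`
with `a + n_F + 1 ≥ E₀`; monotone cells need `a ≥ ℓ + 1`, interval cells `a > unitarityBound3D ℓ`
and `a ≥ ℓ + τ`; chord cells need node ratios `≥ 1/2` for the cell width (and every cell the global
`s`-width ratios). [cite: HogervorstRychkov2013, §3 eq. (3.9)] -/
theorem headCell₂_twoSign_of_rules {n : ℕ} (am ap z zb : Fin n → ℝ)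
    (hz : ∀ k, z k ∈ Ioo (0 : ℝ) 1) (hzb : ∀ k, zb k ∈ Ioo (0 : ℝ) 1) (hord : ∀ k, zb k ≤ z k)
    (apex : Fin n) (hapex : 0 ≤ am apex + ap apex) (qd qr : Fin n → ℝ)
    (hqd : ∀ k, 0 < qd k ∧ qd k ≤ 1) (hqr : ∀ k, 0 < qr k ∧ qr k ≤ 1)
    (hdomd : ∀ k, z k * zb k ≤ qd k ^ 2 * (z apex * zb apex) ∧ z k ≤ qd k * z apex)
    (hdomr : ∀ k, (1 - z k) * (1 - zb k) ≤ qr k ^ 2 * (z apex * zb apex) ∧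
      1 - zb k ≤ qr k * z apex)
    {slo shi E₀ ET τ : ℝ} (hτ1 : τ ≤ 1)
    (hM : ∀ (j : ℕ) (E : ℝ), E₀ ≤ E → E < ET → (j : ℝ) + τ ≤ E → ∀ s ∈ Icc slo shi,
      0 ≤ twoSignTerm am ap z zb s E j)
    (hB : apexRest₂ (am + ap) (am - ap) z zb apex qd qr slo ET ≤
      (am apex + ap apex) * ((1 - z apex) * (1 - zb apex)) ^ shi)
    (hr : ∀ k, 1 / 2 ≤ ((1 - z k) * (1 - zb k)) ^ (shi - slo) ∧ 1 / 2 ≤ (z k * zb k) ^ (shi - slo))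
    {ℓ : ℕ} {a b : ℝ} (nF : ℕ) (hnF : E₀ ≤ a + ((nF : ℝ) + 1)) (useChord useInterval : Bool)
    (h1 : useInterval = false → (ℓ : ℝ) + 1 ≤ a)
    (h2 : useInterval = true → unitarityBound3D ℓ < a ∧ (ℓ : ℝ) + τ ≤ a)
    (hρ : useChord = true → ∀ k, 1 / 2 ≤ (z k * zb k) ^ ((b - a) / 2) ∧
      1 / 2 ≤ ((1 - z k) * (1 - zb k)) ^ ((b - a) / 2))
    (hnum : 0 ≤ headCellNumber₂ am ap z zb ℓ a b slo shi nF useChord useInterval) :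
    ∀ s ∈ Icc slo shi, ∀ Δ ∈ Ico a b, TwoSignPositive am ap z zb s Δ ℓ := by
  -- the two term-bound tables on the shifted cells
  have hΦc : ∀ q ∈ headSet ℓ nF, ∀ Δ ∈ Icc a b, ∀ s ∈ Icc slo shi,
      cornerBound₂ (am + ap) (am - ap) z zb q.2 (a + q.1) (b + q.1) slo shi ≤
        twoSignTerm am ap z zb s (Δ + (q.1 : ℝ)) q.2 :=
    fun q _ Δ hΔ s hs => cornerBound₂_le_twoSignTerm am ap z zb hz hzb q.2
      (⟨by linarith [hΔ.1], by linarith [hΔ.2]⟩ : Δ + (q.1 : ℝ) ∈ Icc (a + q.1) (b + q.1)) hs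
  have hΦd : useChord = true → ∀ q ∈ headSet ℓ nF, ∀ Δ ∈ Icc a b, ∀ s ∈ Icc slo shi,
      termChordMin₂ (am + ap) (am - ap) z zb q.2 slo shi (a + q.1) (b + q.1) ≤
        twoSignTerm am ap z zb s (Δ + (q.1 : ℝ)) q.2 := by
    intro hc q _ Δ hΔ s hs
    have hρ' : ∀ k, 1 / 2 ≤ (z k * zb k) ^ ((b + (q.1 : ℝ) - (a + q.1)) / 2) ∧
        1 / 2 ≤ ((1 - z k) * (1 - zb k)) ^ ((b + (q.1 : ℝ) - (a + q.1)) / 2) := by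
      intro k; rw [show b + (q.1 : ℝ) - (a + q.1) = b - a by ring]; exact hρ hc k
    exact termChordMin₂_le_twoSignTerm am ap z zb hz hzb q.2 hr hρ'
      (⟨by linarith [hΔ.1], by linarith [hΔ.2]⟩ : Δ + (q.1 : ℝ) ∈ Icc (a + q.1) (b + q.1)) hs
  have hF : ∀ q : ℕ × ℕ, q ∉ headSet ℓ nF → InDescendantRange ℓ q.1 q.2 → E₀ ≤ a + q.1 :=
    headSet_off hnF
  cases useInterval with
  | false =>
    have ha : (ℓ : ℝ) + 1 ≤ a := h1 rfl
    cases useChord with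
    | false =>
      have hnum' : 0 ≤ headCellBound₂ am ap z zb ℓ a b slo shi (headSet ℓ nF) := by
        simpa [headCellNumber₂] using hnum
      exact headSum_twoSign_of_rules am ap z zb hz hzb hord apex hapex qd qr hqd hqr hdomd hdomr hτ1
        hM hB ha (headSet ℓ nF) hF
        (fun q => cornerBound₂ (am + ap) (am - ap) z zb q.2 (a + q.1) (b + q.1) slo shi) hΦc hnum'
    | true =>
      have hnum' : 0 ≤ headChordBound₂ am ap z zb ℓ a b slo shi (headSet ℓ nF) := by
        simpa [headCellNumber₂] using hnum
      exact headSum_twoSign_of_rules am ap z zb hz hzb hord apex hapex qd qr hqd hqr hdomd hdomr hτ1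
        hM hB ha (headSet ℓ nF) hF
        (fun q => termChordMin₂ (am + ap) (am - ap) z zb q.2 slo shi (a + q.1) (b + q.1)) (hΦd rfl)
        hnum'
  | true =>
    obtain ⟨ha, haτ⟩ := h2 rfl
    cases useChord with
    | false =>
      have hnum' : 0 ≤ headCellBoundI₂ am ap z zb ℓ a b slo shi (headSet ℓ nF) := by
        simpa [headCellNumber₂] using hnum
      exact headSumI_twoSign_of_rules am ap z zb hz hzb hord apex hapex qd qr hqd hqr hdomd hdomr
        hM hB ha haτ (headSet ℓ nF) hF
        (fun q => cornerBound₂ (am + ap) (am - ap) z zb q.2 (a + q.1) (b + q.1) slo shi) hΦc hnum'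
    | true =>
      have hnum' : 0 ≤ headChordBoundI₂ am ap z zb ℓ a b slo shi (headSet ℓ nF) := by
        simpa [headCellNumber₂] using hnum
      exact headSumI_twoSign_of_rules am ap z zb hz hzb hord apex hapex qd qr hqd hqr hdomd hdomr
        hM hB ha haτ (headSet ℓ nF) hF
        (fun q => termChordMin₂ (am + ap) (am - ap) z zb q.2 slo shi (a + q.1) (b + q.1)) (hΦd rfl)
        hnum'

/-! ### Rule (M) boxes with a term-rule bit, and the row's tail from such a table -/

/-- The number of an (M) box of a two-sign row with a term-rule bit: the corner number
`cornerBound₂ (a⁻+a⁺) (a⁻-a⁺) z z̄ j E₁ E₂ s_lo s_hi` or the chord number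
`termChordMin₂ (a⁻+a⁺) (a⁻-a⁺) z z̄ j s_lo s_hi E₁ E₂`. [cite: HogervorstRychkov2013, §3 eq. (3.6)] -/
def boxNumber₂ {n : ℕ} (am ap z zb : Fin n → ℝ) (j : ℕ) (E₁ E₂ slo shi : ℝ) (useChord : Bool) : ℝ :=
  if useChord then termChordMin₂ (am + ap) (am - ap) z zb j slo shi E₁ E₂
  else cornerBound₂ (am + ap) (am - ap) z zb j E₁ E₂ slo shi

/-- A box number `≥ 0` gives termwise positivity on the box (chord boxes: node ratios `≥ 1/2` for the
`s`-width and the box width). [cite: HogervorstRychkov2013, §3 eq. (3.6)] -/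
theorem twoSignTerm_nonneg_of_boxNumber₂ {n : ℕ} (am ap z zb : Fin n → ℝ)
    (hz : ∀ k, z k ∈ Ioo (0 : ℝ) 1) (hzb : ∀ k, zb k ∈ Ioo (0 : ℝ) 1) (j : ℕ)
    {E₁ E₂ slo shi : ℝ}
    (hr : ∀ k, 1 / 2 ≤ ((1 - z k) * (1 - zb k)) ^ (shi - slo) ∧ 1 / 2 ≤ (z k * zb k) ^ (shi - slo))
    (useChord : Bool)
    (hρ : useChord = true → ∀ k, 1 / 2 ≤ (z k * zb k) ^ ((E₂ - E₁) / 2) ∧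
      1 / 2 ≤ ((1 - z k) * (1 - zb k)) ^ ((E₂ - E₁) / 2))
    (h : 0 ≤ boxNumber₂ am ap z zb j E₁ E₂ slo shi useChord) :
    ∀ E ∈ Icc E₁ E₂, ∀ s ∈ Icc slo shi, 0 ≤ twoSignTerm am ap z zb s E j := by
  intro E hE s hs
  cases useChord with
  | true =>
    have h' : 0 ≤ termChordMin₂ (am + ap) (am - ap) z zb j slo shi E₁ E₂ := by
      simpa [boxNumber₂] using h
    exact h'.trans (termChordMin₂_le_twoSignTerm am ap z zb hz hzb j hr (hρ rfl) hE hs)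
  | false =>
    have h' : 0 ≤ cornerBound₂ (am + ap) (am - ap) z zb j E₁ E₂ slo shi := by
      simpa [boxNumber₂] using h
    exact twoSignTerm_nonneg_of_cornerBound₂ am ap z zb hz hzb j h' E hE s hs

/-- **(M) on the twist-gap domain from a box table with term bits.** For every `j` with `j + τ < E_T`
a row of boxes from `≤ max(E₀, j + τ)` to `≥ E_T`, each with a bit and a number `boxNumber₂ ≥ 0`
(chord boxes with their node-ratio side condition). [cite: HogervorstRychkov2013, §3 eq. (3.6)] -/
theorem ruleM_twoSign_of_boxTable₂ {n : ℕ} (am ap z zb : Fin n → ℝ)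
    (hz : ∀ k, z k ∈ Ioo (0 : ℝ) 1) (hzb : ∀ k, zb k ∈ Ioo (0 : ℝ) 1)
    {slo shi E₀ ET : ℝ} (τ : ℝ)
    (hr : ∀ k, 1 / 2 ≤ ((1 - z k) * (1 - zb k)) ^ (shi - slo) ∧ 1 / 2 ≤ (z k * zb k) ^ (shi - slo))
    (e : ℕ → ℕ → ℝ) (M : ℕ → ℕ) (bc : ℕ → ℕ → Bool)
    (he : ∀ j : ℕ, (j : ℝ) + τ < ET → e j 0 ≤ max E₀ ((j : ℝ) + τ) ∧ ET ≤ e j (M j))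
    (hρ : ∀ j m, m < M j → bc j m = true → ∀ k, 1 / 2 ≤ (z k * zb k) ^ ((e j (m + 1) - e j m) / 2) ∧
      1 / 2 ≤ ((1 - z k) * (1 - zb k)) ^ ((e j (m + 1) - e j m) / 2))
    (hbox : ∀ j : ℕ, (j : ℝ) + τ < ET → ∀ m < M j,
      0 ≤ boxNumber₂ am ap z zb j (e j m) (e j (m + 1)) slo shi (bc j m)) :
    ∀ (j : ℕ) (E : ℝ), E₀ ≤ E → E < ET → (j : ℝ) + τ ≤ E → ∀ s ∈ Icc slo shi,
      0 ≤ twoSignTerm am ap z zb s E j := by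
  intro j E hE0 hET hjE s hs
  have hjT : (j : ℝ) + τ < ET := lt_of_le_of_lt hjE hET
  obtain ⟨he0, heM⟩ := he j hjT
  have hE : E ∈ Ico (e j 0) (e j (M j)) := ⟨he0.trans (max_le hE0 hjE), lt_of_lt_of_le hET heM⟩
  obtain ⟨m, hm, hEm⟩ := exists_cell_Ico (e j) (M j) E hE
  exact twoSignTerm_nonneg_of_boxNumber₂ am ap z zb hz hzb j hr (bc j m) (hρ j m hm)
    (hbox j hjT m hm) E ⟨hEm.1, hEm.2.le⟩ s hs

/-- **The tail of a two-sign row from a box table with term bits and one apex inequality** (refines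
`tail_twoSignPositive_of_table_and_apex`). [cite: HogervorstRychkov2013, §3 eq. (3.6)] -/
theorem tail_twoSignPositive_of_table₂_and_apex {n : ℕ} (am ap z zb : Fin n → ℝ)
    (hz : ∀ k, z k ∈ Ioo (0 : ℝ) 1) (hzb : ∀ k, zb k ∈ Ioo (0 : ℝ) 1) (hord : ∀ k, zb k ≤ z k)
    (a : Fin n) (ha : 0 ≤ am a + ap a) (qd qr : Fin n → ℝ) (hqd : ∀ k, 0 < qd k ∧ qd k ≤ 1)
    (hqr : ∀ k, 0 < qr k ∧ qr k ≤ 1)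
    (hdomd : ∀ k, z k * zb k ≤ qd k ^ 2 * (z a * zb a) ∧ z k ≤ qd k * z a)
    (hdomr : ∀ k, (1 - z k) * (1 - zb k) ≤ qr k ^ 2 * (z a * zb a) ∧ 1 - zb k ≤ qr k * z a)
    {slo shi E₀ ET τ : ℝ} (hτ1 : τ ≤ 1) (hτ0 : τ ≤ E₀)
    (hr : ∀ k, 1 / 2 ≤ ((1 - z k) * (1 - zb k)) ^ (shi - slo) ∧ 1 / 2 ≤ (z k * zb k) ^ (shi - slo))
    (e : ℕ → ℕ → ℝ) (M : ℕ → ℕ) (bc : ℕ → ℕ → Bool)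
    (he : ∀ j : ℕ, (j : ℝ) + τ < ET → e j 0 ≤ max E₀ ((j : ℝ) + τ) ∧ ET ≤ e j (M j))
    (hρ : ∀ j m, m < M j → bc j m = true → ∀ k, 1 / 2 ≤ (z k * zb k) ^ ((e j (m + 1) - e j m) / 2) ∧
      1 / 2 ≤ ((1 - z k) * (1 - zb k)) ^ ((e j (m + 1) - e j m) / 2))
    (hbox : ∀ j : ℕ, (j : ℝ) + τ < ET → ∀ m < M j,
      0 ≤ boxNumber₂ am ap z zb j (e j m) (e j (m + 1)) slo shi (bc j m))
    (hB : apexRest₂ (am + ap) (am - ap) z zb a qd qr slo ET ≤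
      (am a + ap a) * ((1 - z a) * (1 - zb a)) ^ shi) :
    ∀ s ∈ Icc slo shi, ∀ ℓ : ℕ, ∀ Δ : ℝ, unitarityBound3D ℓ ≤ Δ → E₀ ≤ Δ →
      TwoSignPositive am ap z zb s Δ ℓ :=
  tail_twoSignPositive_of_boxes_and_apex am ap z zb hz hzb hord a ha qd qr hqd hqr hdomd hdomr hτ1 hτ0
    (ruleM_twoSign_of_boxTable₂ am ap z zb hz hzb τ hr e M bc he hρ hbox) hB

/-! ### The unit row -/

/-- The unit row is the `(E, j) = (0, 0)` term: `φ[a⁻](F^{s}_{-}[1]) + φ[a⁺](F^{s}_{+}[1]) =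
twoSignTerm a⁻ a⁺ z z̄ s 0 0` (`𝒫_{0,0} ≡ 1`). [cite: KosPolandSimmonsduffin2014ON, §2.1] -/
theorem twoSign_identity_eq {n : ℕ} (am ap z zb : Fin n → ℝ) (s : ℝ) :
    pointFunctional am z zb (crossF s (-1) (fun _ _ => (1 : ℝ))) +
        pointFunctional ap z zb (crossF s 1 (fun _ _ => (1 : ℝ))) =
      twoSignTerm am ap z zb s 0 0 := by
  rw [twoSignTerm, ← zMono_zero_zero]

/-- **(O1) of a vector certificate on a box from one number.**
`0 < cornerBound₂ (a⁻+a⁺) (a⁻-a⁺) z z̄ 0 0 0 s_lo s_hi` gives `φ[a⁻](F^{s}_{-}[1]) + φ[a⁺](F^{s}_{+}[1]) > 0`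
for every `s ∈ [s_lo, s_hi]`. [cite: RattazziEtAl2008, §5.5] -/
theorem twoSign_identity_pos_of_cornerBound₂ {n : ℕ} (am ap z zb : Fin n → ℝ)
    (hz : ∀ k, z k ∈ Ioo (0 : ℝ) 1) (hzb : ∀ k, zb k ∈ Ioo (0 : ℝ) 1) {slo shi : ℝ}
    (h : 0 < cornerBound₂ (am + ap) (am - ap) z zb 0 0 0 slo shi) :
    ∀ s ∈ Icc slo shi, 0 < pointFunctional am z zb (crossF s (-1) (fun _ _ => (1 : ℝ))) +
      pointFunctional ap z zb (crossF s 1 (fun _ _ => (1 : ℝ))) := by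
  intro s hs
  rw [twoSign_identity_eq]
  exact h.trans_le (cornerBound₂_le_twoSignTerm am ap z zb hz hzb 0 ⟨le_rfl, le_rfl⟩ hs)

/-- **The unit row from one chord number** on an `s`-interval `[a, b]` with node ratios `≥ 1/2`
for the width `b - a` (the two-sign analogue of `identity_pos_of_chordMin`).
[cite: HogervorstRychkov2013, §3 eq. (3.6)] -/
theorem twoSign_identity_pos_of_chordMin₂ {n : ℕ} (am ap z zb : Fin n → ℝ)
    (hz : ∀ k, z k ∈ Ioo (0 : ℝ) 1) (hzb : ∀ k, zb k ∈ Ioo (0 : ℝ) 1) {a b : ℝ}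
    (hri : ∀ k, 1 / 2 ≤ ((1 - z k) * (1 - zb k)) ^ (b - a) ∧ 1 / 2 ≤ (z k * zb k) ^ (b - a))
    (h : 0 < termChordMin₂ (am + ap) (am - ap) z zb 0 a b 0 0) {s : ℝ} (hs : s ∈ Icc a b) :
    0 < pointFunctional am z zb (crossF s (-1) (fun _ _ => (1 : ℝ))) +
      pointFunctional ap z zb (crossF s 1 (fun _ _ => (1 : ℝ))) := by
  have hρ : ∀ k, 1 / 2 ≤ (z k * zb k) ^ (((0 : ℝ) - 0) / 2) ∧
      1 / 2 ≤ ((1 - z k) * (1 - zb k)) ^ (((0 : ℝ) - 0) / 2) := by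
    intro k
    simp only [sub_self, zero_div, Real.rpow_zero]
    norm_num
  rw [twoSign_identity_eq]
  exact h.trans_le (termChordMin₂_le_twoSignTerm am ap z zb hz hzb 0 hri hρ ⟨le_rfl, le_rfl⟩ hs)

/-- **The unit row from a chord ROW** (`boxExcluded_of_pointTable₂S`'s identity rule, two-sign):
node ratios `≥ 1/2` for the full `s`-width, a monotone partition `s_lo = σ_0 ≤ ⋯ ≤ σ_{K_I} = s_hi`
(`K_I ≥ 1`) and `0 < termChordMin₂ (a⁻+a⁺) (a⁻-a⁺) z z̄ 0 σ_i σ_{i+1} 0 0` on every piece.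
[cite: HogervorstRychkov2013, §3 eq. (3.6)] -/
theorem twoSign_identity_pos_of_chordRow₂ {n : ℕ} (am ap z zb : Fin n → ℝ)
    (hz : ∀ k, z k ∈ Ioo (0 : ℝ) 1) (hzb : ∀ k, zb k ∈ Ioo (0 : ℝ) 1) {slo shi : ℝ}
    (hr : ∀ k, 1 / 2 ≤ ((1 - z k) * (1 - zb k)) ^ (shi - slo) ∧ 1 / 2 ≤ (z k * zb k) ^ (shi - slo))
    (σ : ℕ → ℝ) (KI : ℕ) (hKI : 0 < KI) (hσ0 : σ 0 = slo) (hσK : σ KI = shi)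
    (hmono : ∀ i < KI, σ i ≤ σ (i + 1))
    (hrow : ∀ i < KI, 0 < termChordMin₂ (am + ap) (am - ap) z zb 0 (σ i) (σ (i + 1)) 0 0) :
    ∀ s ∈ Icc slo shi, 0 < pointFunctional am z zb (crossF s (-1) (fun _ _ => (1 : ℝ))) +
      pointFunctional ap z zb (crossF s 1 (fun _ _ => (1 : ℝ))) := by
  intro s hs
  obtain ⟨i, hi, hmem⟩ := exists_piece_Icc σ KI hKI s ⟨hσ0 ▸ hs.1, hσK ▸ hs.2⟩
  have hb := piece_sub_of_monotone σ KI hmono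
  have hwid : σ (i + 1) - σ i ≤ shi - slo := by
    have h1 := (hb (i + 1) (by omega)).2
    have h2 := (hb i hi.le).1
    rw [hσK] at h1; rw [hσ0] at h2
    linarith
  exact twoSign_identity_pos_of_chordMin₂ am ap z zb hz hzb
    (nodeRatios_of_width_le z zb hz hzb hwid hr) (hrow i hi) hmem

/-! ### Gluing half-open cells into the range obligations -/

/-- Consecutive half-open cells cover `[t₀, t_K)` (no monotonicity of `t` needed; the cell tables of a
functional certificate). [cite: RattazziEtAl2008, §5.5] -/
theorem twoSignPositive_of_cells_Ico {n : ℕ} {am ap z zb : Fin n → ℝ} {S : Set ℝ} {ℓ : ℕ}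
    (t : ℕ → ℝ) :
    ∀ K : ℕ, (∀ k < K, ∀ s ∈ S, ∀ Δ ∈ Ico (t k) (t (k + 1)), TwoSignPositive am ap z zb s Δ ℓ) →
      ∀ s ∈ S, ∀ Δ ∈ Ico (t 0) (t K), TwoSignPositive am ap z zb s Δ ℓ := by
  intro K
  induction K with
  | zero => intro _ s _ Δ hΔ; exact absurd hΔ.2 (not_lt.2 hΔ.1)
  | succ K ih =>
    intro hcell s hs Δ hΔ
    by_cases hK : Δ < t K
    · exact ih (fun k hk => hcell k (by omega)) s hs Δ ⟨hΔ.1, hK⟩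
    · exact hcell K (by omega) s hs Δ ⟨not_lt.1 hK, hΔ.2⟩

/-- The scalar range obligation of a two-sign row (`ℓ = 0`, `Δ_gap ≤ Δ < E`; (O2)/(O3) of a vector
certificate) from half-open cells with `t₀ ≤ Δ_gap` and `t_K = E`. [cite: RattazziEtAl2008, §5.5] -/
theorem scalar_twoSign_of_cells {n : ℕ} {am ap z zb : Fin n → ℝ} {S : Set ℝ} {gap E : ℝ}
    (t : ℕ → ℝ) (K : ℕ) (h0 : t 0 ≤ gap) (hK : t K = E)
    (hcell : ∀ k < K, ∀ s ∈ S, ∀ Δ ∈ Ico (t k) (t (k + 1)), TwoSignPositive am ap z zb s Δ 0) :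
    ∀ s ∈ S, ∀ Δ : ℝ, gap ≤ Δ → Δ < E → TwoSignPositive am ap z zb s Δ 0 :=
  fun s hs Δ hgap hlt => twoSignPositive_of_cells_Ico t K hcell s hs Δ ⟨h0.trans hgap, hK ▸ hlt⟩

/-- The spinning range obligation of a two-sign row for the spins with a prescribed property `P`
(`Even ℓ ∧ ℓ ≠ 0` for the singlet and traceless-symmetric rows, `Odd ℓ` for the antisymmetric row;
(O4)/(O5)/(O6) of a vector certificate): spins bounded by `L` (`E ≤ L + 1`), and for each `ℓ < L`
with `P ℓ` a row `t_{ℓ,0} ≤ ℓ + 1`, `t_{ℓ,K_ℓ} = E` of half-open cells. [cite: RattazziEtAl2008, §5.5] -/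
theorem spin_twoSign_of_cells {n : ℕ} {am ap z zb : Fin n → ℝ} {S : Set ℝ} {E : ℝ}
    (P : ℕ → Prop) (L : ℕ) (hL : E ≤ (L : ℝ) + 1) (t : ℕ → ℕ → ℝ) (K : ℕ → ℕ)
    (h0 : ∀ ℓ, P ℓ → ℓ < L → t ℓ 0 ≤ (ℓ : ℝ) + 1)
    (hK : ∀ ℓ, P ℓ → ℓ < L → t ℓ (K ℓ) = E)
    (hcell : ∀ ℓ, P ℓ → ℓ < L → ∀ k < K ℓ, ∀ s ∈ S,
      ∀ Δ ∈ Ico (t ℓ k) (t ℓ (k + 1)), TwoSignPositive am ap z zb s Δ ℓ) :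
    ∀ s ∈ S, ∀ ℓ : ℕ, P ℓ → ∀ Δ : ℝ, (ℓ : ℝ) + 1 ≤ Δ → Δ < E →
      TwoSignPositive am ap z zb s Δ ℓ := by
  intro s hs ℓ hP Δ hΔ1 hΔ2
  have hℓL : ℓ < L := by
    by_contra hge
    have : (L : ℝ) ≤ ℓ := by exact_mod_cast not_lt.1 hge
    linarith
  exact twoSignPositive_of_cells_Ico (t ℓ) (K ℓ) (hcell ℓ hP hℓL) s hs Δ
    ⟨(h0 ℓ hP hℓL).trans hΔ1, (hK ℓ hP hℓL) ▸ hΔ2⟩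

/-- The singlet / traceless-symmetric instance (`P ℓ = (Even ℓ ∧ ℓ ≠ 0)`), in the binder order of the
vector certificate's (O4)/(O5). [cite: RattazziEtAl2008, §5.5] -/
theorem evenSpin_twoSign_of_cells {n : ℕ} {am ap z zb : Fin n → ℝ} {S : Set ℝ} {E : ℝ}
    (L : ℕ) (hL : E ≤ (L : ℝ) + 1) (t : ℕ → ℕ → ℝ) (K : ℕ → ℕ)
    (h0 : ∀ ℓ, Even ℓ → ℓ ≠ 0 → ℓ < L → t ℓ 0 ≤ (ℓ : ℝ) + 1)
    (hK : ∀ ℓ, Even ℓ → ℓ ≠ 0 → ℓ < L → t ℓ (K ℓ) = E)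
    (hcell : ∀ ℓ, Even ℓ → ℓ ≠ 0 → ℓ < L → ∀ k < K ℓ, ∀ s ∈ S,
      ∀ Δ ∈ Ico (t ℓ k) (t ℓ (k + 1)), TwoSignPositive am ap z zb s Δ ℓ) :
    ∀ s ∈ S, ∀ ℓ : ℕ, Even ℓ → ℓ ≠ 0 → ∀ Δ : ℝ, (ℓ : ℝ) + 1 ≤ Δ → Δ < E →
      TwoSignPositive am ap z zb s Δ ℓ :=
  fun s hs ℓ hev hℓ =>
    spin_twoSign_of_cells (fun ℓ => Even ℓ ∧ ℓ ≠ 0) L hL t K (fun ℓ h => h0 ℓ h.1 h.2)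
      (fun ℓ h => hK ℓ h.1 h.2) (fun ℓ h => hcell ℓ h.1 h.2) s hs ℓ ⟨hev, hℓ⟩

/-- The antisymmetric instance (`P = Odd`), in the binder order of the vector certificate's (O6).
[cite: RattazziEtAl2008, §5.5] -/
theorem oddSpin_twoSign_of_cells {n : ℕ} {am ap z zb : Fin n → ℝ} {S : Set ℝ} {E : ℝ}
    (L : ℕ) (hL : E ≤ (L : ℝ) + 1) (t : ℕ → ℕ → ℝ) (K : ℕ → ℕ)
    (h0 : ∀ ℓ, Odd ℓ → ℓ < L → t ℓ 0 ≤ (ℓ : ℝ) + 1)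
    (hK : ∀ ℓ, Odd ℓ → ℓ < L → t ℓ (K ℓ) = E)
    (hcell : ∀ ℓ, Odd ℓ → ℓ < L → ∀ k < K ℓ, ∀ s ∈ S,
      ∀ Δ ∈ Ico (t ℓ k) (t ℓ (k + 1)), TwoSignPositive am ap z zb s Δ ℓ) :
    ∀ s ∈ S, ∀ ℓ : ℕ, Odd ℓ → ∀ Δ : ℝ, (ℓ : ℝ) + 1 ≤ Δ → Δ < E →
      TwoSignPositive am ap z zb s Δ ℓ :=
  spin_twoSign_of_cells Odd L hL t K h0 hK hcell

/-! ### A whole row family from finite tables -/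

/-- **The scalar range of a two-sign row family from finite tables**: `ℓ = 0`, `Δ_gap ≤ Δ < E₀`, every
`s ∈ [s_lo, s_hi]`, from half-open head cells `[t_k, t_{k+1})` (`t₀ ≤ Δ_gap`, `t_K = E₀`), each with a
head level `n_F` (`t_k + n_F + 1 ≥ E₀`), a term bit (chord cells: node ratios `≥ 1/2` for the width),
a coefficient bit (monotone: `t_k ≥ 1`; interval: `t_k > 1/2` and `t_k ≥ τ` — the cells between the
unitarity bound and `1`) and ONE number `headCellNumber₂ ≥ 0`; the (M) box table with term bits;
the apex inequality of the family's tail; the `s`-width node ratios. [cite: RattazziEtAl2008, §5.5] -/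
theorem scalarRange_twoSign_of_pointTables {n : ℕ} (am ap z zb : Fin n → ℝ)
    (hz : ∀ k, z k ∈ Ioo (0 : ℝ) 1) (hzb : ∀ k, zb k ∈ Ioo (0 : ℝ) 1) (hord : ∀ k, zb k ≤ z k)
    (apex : Fin n) (hapex : 0 ≤ am apex + ap apex) (qd qr : Fin n → ℝ)
    (hqd : ∀ k, 0 < qd k ∧ qd k ≤ 1) (hqr : ∀ k, 0 < qr k ∧ qr k ≤ 1)
    (hdomd : ∀ k, z k * zb k ≤ qd k ^ 2 * (z apex * zb apex) ∧ z k ≤ qd k * z apex)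
    (hdomr : ∀ k, (1 - z k) * (1 - zb k) ≤ qr k ^ 2 * (z apex * zb apex) ∧
      1 - zb k ≤ qr k * z apex)
    {slo shi E₀ ET τ : ℝ} (hτ1 : τ ≤ 1)
    (hr : ∀ k, 1 / 2 ≤ ((1 - z k) * (1 - zb k)) ^ (shi - slo) ∧ 1 / 2 ≤ (z k * zb k) ^ (shi - slo))
    (e : ℕ → ℕ → ℝ) (M : ℕ → ℕ) (bc : ℕ → ℕ → Bool)
    (he : ∀ j : ℕ, (j : ℝ) + τ < ET → e j 0 ≤ max E₀ ((j : ℝ) + τ) ∧ ET ≤ e j (M j))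
    (hρM : ∀ j m, m < M j → bc j m = true → ∀ k, 1 / 2 ≤ (z k * zb k) ^ ((e j (m + 1) - e j m) / 2) ∧
      1 / 2 ≤ ((1 - z k) * (1 - zb k)) ^ ((e j (m + 1) - e j m) / 2))
    (hbox : ∀ j : ℕ, (j : ℝ) + τ < ET → ∀ m < M j,
      0 ≤ boxNumber₂ am ap z zb j (e j m) (e j (m + 1)) slo shi (bc j m))
    (hB : apexRest₂ (am + ap) (am - ap) z zb apex qd qr slo ET ≤
      (am apex + ap apex) * ((1 - z apex) * (1 - zb apex)) ^ shi)
    {gap : ℝ} (t : ℕ → ℝ) (K : ℕ) (h0 : t 0 ≤ gap) (hK : t K = E₀) (nF : ℕ → ℕ)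
    (c i : ℕ → Bool)
    (h1 : ∀ k < K, i k = false → (1 : ℝ) ≤ t k)
    (h2 : ∀ k < K, i k = true → (1 / 2 : ℝ) < t k ∧ τ ≤ t k)
    (hρ : ∀ k < K, c k = true → ∀ m, 1 / 2 ≤ (z m * zb m) ^ ((t (k + 1) - t k) / 2) ∧
      1 / 2 ≤ ((1 - z m) * (1 - zb m)) ^ ((t (k + 1) - t k) / 2))
    (hnF : ∀ k < K, E₀ ≤ t k + ((nF k : ℝ) + 1))
    (hhead : ∀ k < K, 0 ≤ headCellNumber₂ am ap z zb 0 (t k) (t (k + 1)) slo shi (nF k) (c k) (i k)) :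
    ∀ s ∈ Icc slo shi, ∀ Δ : ℝ, gap ≤ Δ → Δ < E₀ → TwoSignPositive am ap z zb s Δ 0 := by
  have hb0 : unitarityBound3D 0 = 1 / 2 := by simp [unitarityBound3D]
  have hM := ruleM_twoSign_of_boxTable₂ am ap z zb hz hzb τ hr e M bc he hρM hbox
  exact scalar_twoSign_of_cells t K h0 hK fun k hk =>
    headCell₂_twoSign_of_rules am ap z zb hz hzb hord apex hapex qd qr hqd hqr hdomd hdomr hτ1 hM hB
      hr (ℓ := 0) (nF k) (hnF k hk) (c k) (i k) (fun h => by simpa using h1 k hk h)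
      (fun h => ⟨by rw [hb0]; exact (h2 k hk h).1, by simpa using (h2 k hk h).2⟩) (hρ k hk)
      (hhead k hk)

/-- **The spinning range of a two-sign row family from finite tables**: every spin `ℓ < L` with the
prescribed property `P` (`E₀ ≤ L + 1`), `ℓ + 1 ≤ Δ < E₀`, every `s ∈ [s_lo, s_hi]`, from one row of
half-open head cells per spin (`t_{ℓ,0} ≤ ℓ + 1 ≤ t_{ℓ,k}`, `t_{ℓ,K_ℓ} = E₀`; monotone tables), each
with a head level, a term bit (chord cells with their node ratios) and ONE number
`headCellNumber₂ … false ≥ 0`; the (M) box table with term bits; the apex inequality of the family's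
tail; the `s`-width node ratios. [cite: RattazziEtAl2008, §5.5] -/
theorem spinRange_twoSign_of_pointTables {n : ℕ} (am ap z zb : Fin n → ℝ)
    (hz : ∀ k, z k ∈ Ioo (0 : ℝ) 1) (hzb : ∀ k, zb k ∈ Ioo (0 : ℝ) 1) (hord : ∀ k, zb k ≤ z k)
    (apex : Fin n) (hapex : 0 ≤ am apex + ap apex) (qd qr : Fin n → ℝ)
    (hqd : ∀ k, 0 < qd k ∧ qd k ≤ 1) (hqr : ∀ k, 0 < qr k ∧ qr k ≤ 1)
    (hdomd : ∀ k, z k * zb k ≤ qd k ^ 2 * (z apex * zb apex) ∧ z k ≤ qd k * z apex)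
    (hdomr : ∀ k, (1 - z k) * (1 - zb k) ≤ qr k ^ 2 * (z apex * zb apex) ∧
      1 - zb k ≤ qr k * z apex)
    {slo shi E₀ ET τ : ℝ} (hτ1 : τ ≤ 1)
    (hr : ∀ k, 1 / 2 ≤ ((1 - z k) * (1 - zb k)) ^ (shi - slo) ∧ 1 / 2 ≤ (z k * zb k) ^ (shi - slo))
    (e : ℕ → ℕ → ℝ) (M : ℕ → ℕ) (bc : ℕ → ℕ → Bool)
    (he : ∀ j : ℕ, (j : ℝ) + τ < ET → e j 0 ≤ max E₀ ((j : ℝ) + τ) ∧ ET ≤ e j (M j))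
    (hρM : ∀ j m, m < M j → bc j m = true → ∀ k, 1 / 2 ≤ (z k * zb k) ^ ((e j (m + 1) - e j m) / 2) ∧
      1 / 2 ≤ ((1 - z k) * (1 - zb k)) ^ ((e j (m + 1) - e j m) / 2))
    (hbox : ∀ j : ℕ, (j : ℝ) + τ < ET → ∀ m < M j,
      0 ≤ boxNumber₂ am ap z zb j (e j m) (e j (m + 1)) slo shi (bc j m))
    (hB : apexRest₂ (am + ap) (am - ap) z zb apex qd qr slo ET ≤
      (am apex + ap apex) * ((1 - z apex) * (1 - zb apex)) ^ shi)
    (P : ℕ → Prop) (L : ℕ) (hL : E₀ ≤ (L : ℝ) + 1) (t : ℕ → ℕ → ℝ) (K : ℕ → ℕ)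
    (ht0 : ∀ ℓ, P ℓ → ℓ < L → t ℓ 0 ≤ (ℓ : ℝ) + 1)
    (htK : ∀ ℓ, P ℓ → ℓ < L → t ℓ (K ℓ) = E₀)
    (hta : ∀ ℓ, P ℓ → ℓ < L → ∀ k < K ℓ, (ℓ : ℝ) + 1 ≤ t ℓ k)
    (nF : ℕ → ℕ → ℕ) (c : ℕ → ℕ → Bool)
    (hρ : ∀ ℓ, P ℓ → ℓ < L → ∀ k < K ℓ, c ℓ k = true → ∀ m,
      1 / 2 ≤ (z m * zb m) ^ ((t ℓ (k + 1) - t ℓ k) / 2) ∧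
        1 / 2 ≤ ((1 - z m) * (1 - zb m)) ^ ((t ℓ (k + 1) - t ℓ k) / 2))
    (hnF : ∀ ℓ, P ℓ → ℓ < L → ∀ k < K ℓ, E₀ ≤ t ℓ k + ((nF ℓ k : ℝ) + 1))
    (hhead : ∀ ℓ, P ℓ → ℓ < L → ∀ k < K ℓ,
      0 ≤ headCellNumber₂ am ap z zb ℓ (t ℓ k) (t ℓ (k + 1)) slo shi (nF ℓ k) (c ℓ k) false) :
    ∀ s ∈ Icc slo shi, ∀ ℓ : ℕ, P ℓ → ∀ Δ : ℝ, (ℓ : ℝ) + 1 ≤ Δ → Δ < E₀ →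
      TwoSignPositive am ap z zb s Δ ℓ := by
  have hM := ruleM_twoSign_of_boxTable₂ am ap z zb hz hzb τ hr e M bc he hρM hbox
  exact spin_twoSign_of_cells P L hL t K ht0 htK fun ℓ hP hℓ k hk =>
    headCell₂_twoSign_of_rules am ap z zb hz hzb hord apex hapex qd qr hqd hqr hdomd hdomr hτ1 hM hB
      hr (nF ℓ k) (hnF ℓ hP hℓ k hk) (c ℓ k) false (fun _ => hta ℓ hP hℓ k hk)
      (fun h => absurd h Bool.false_ne_true) (hρ ℓ hP hℓ k hk) (hhead ℓ hP hℓ k hk)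

end Literature.MathematicalPhysics.QuantumFieldTheory.ConformalBootstrap3D
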